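import Summits.Ventures.PercRepro.GenQBalance

/-!
# PercRepro — C-025 at `(q + 2, q)`: the exact charging identity of the type-`2` balance and the local form `(★)`
(p3 for night-2's lane, ruling (qn); the identity of mine-4 INBOX 3893 / STAR-NOTES, twinned by the engine 3910)

For a simple matroid `M` and a rank-`q` set `G ⊆ E`, the landed type-`2` balance `Jq M G q 2` (`GenQBalance`) is
`Σ_{S ∈ R_q(G)} q·w_∞(S) − Φ·#{S ∈ R_q(G) : ρ(G ∖ S) ≥ 2}`, `Φ = (q + 2)/(q + 1)`.  Split `R_q(G)` into the BASES
of `G` (`q` points, `w_∞ = 1/(q + 1)`) and the SPANNING NON-BASES `S`; write `s(S) = q·w_∞(S) − Φ·[ρ(G ∖ S) ≥ 2]`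
(the surplus) and `rec(B) = Σ_{S ⊋ B spanning} s(S)/b(S)` (`b(S)` = the bases inside `S`: the uniform charging).
* `Jq_two_eq`: `J_2 = −(2/(q + 1))·#𝓑_dem + (q/(q + 1))·#𝓑_nondem + Σ_S s(S)` (`B` demanded iff `ρ(G ∖ B) ≥ 2`);
* `sum_surplus_eq_sum_rec`: `Σ_S s(S) = Σ_B rec(B)` (exact double counting);
* `surplus_nonneg`: on a simple matroid a spanning non-basis has `m(S) ≤ q − 2` coloops
  (`mTr_add_two_le_of_spanning_nonbasis`), hence `s(S) ≥ q/(q − 1) − Φ > 0`;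
* **`Jq_two_nonneg_of_star`**: `(★)` — `rec(B) ≥ 2/(q + 1)` on every demanded basis (`StarCharge M G q`, an
  unproved `Prop`) — gives `0 ≤ Jq M G q 2`.  Imports `GenQBalance` only.
-/
namespace PercRepro.Star

open Finset ThmH SixFour GenQ

variable {α : Type*} [DecidableEq α] {M : Matroid α} [M.Finite]

/-! ## The objects -/

/-- The bases of `G` (as a rank-`q` set): the rank-`q` subsets with exactly `q` points. -/
noncomputable def Bq (M : Matroid α) [M.Finite] (G : Finset α) (q : ℕ) : Finset (Finset α) :=
  (Rq M G q).filter (fun B : Finset α => B.card = q)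

/-- The spanning non-bases of `G`: the rank-`q` subsets with more than `q` points. -/
noncomputable def SNq (M : Matroid α) [M.Finite] (G : Finset α) (q : ℕ) : Finset (Finset α) :=
  (Rq M G q).filter (fun S : Finset α => ¬ S.card = q)

/-- `b(S)`: the number of bases of `G` inside `S`. -/
noncomputable def bIn (M : Matroid α) [M.Finite] (G : Finset α) (q : ℕ) (S : Finset α) : ℕ :=
  ((Bq M G q).filter (fun B : Finset α => B ⊆ S)).card

/-- The demand of a rank-`q` subset `S`: `Φ = (q + 2)/(q + 1)` when `ρ(G ∖ S) ≥ 2`, else `0`. -/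
noncomputable def dem (M : Matroid α) [M.Finite] (G : Finset α) (q : ℕ) (S : Finset α) : ℚ :=
  if (2 : ℕ∞) ≤ M.eRk ((G \ S : Finset α) : Set α) then ((q : ℚ) + 2) / ((q : ℚ) + 1) else 0

/-- The surplus `s(S) = q·w_∞(S) − Φ·[ρ(G ∖ S) ≥ 2]` of a rank-`q` subset (the type-`2` balance term). -/
noncomputable def surplus (M : Matroid α) [M.Finite] (G : Finset α) (q : ℕ) (S : Finset α) : ℚ :=
  (q : ℚ) * wInf M S - dem M G q S

/-- `rec(B) = Σ_{S ⊋ B spanning non-basis} s(S)/b(S)`: what the basis `B` receives under the uniform charging. -/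
noncomputable def rec (M : Matroid α) [M.Finite] (G : Finset α) (q : ℕ) (B : Finset α) : ℚ :=
  ∑ S ∈ (SNq M G q).filter (fun S : Finset α => B ⊆ S), surplus M G q S / (bIn M G q S : ℚ)

/-- **`(★)`, the local form of the type-`2` balance** (mine-4 3893): every demanded basis `B` of `G`
(`ρ(G ∖ B) ≥ 2`) receives at least its deficit `2/(q + 1)`. -/
def StarCharge (M : Matroid α) [M.Finite] (G : Finset α) (q : ℕ) : Prop :=
  ∀ B ∈ Bq M G q, (2 : ℕ∞) ≤ M.eRk ((G \ B : Finset α) : Set α) → 2 / ((q : ℚ) + 1) ≤ rec M G q B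

/-! ## Elementary facts -/

omit [DecidableEq α] [M.Finite] in
/-- The rank of a finset is a natural number. -/
theorem exists_eRk_eq_nat (X : Finset α) : ∃ k : ℕ, M.eRk (X : Set α) = k := by
  have h := M.eRk_le_encard (X : Set α)
  rw [Set.encard_coe_eq_coe_finsetCard] at h
  obtain ⟨k, hk⟩ := ENat.ne_top_iff_exists.1 (ne_top_of_le_ne_top (ENat.coe_ne_top _) h)
  exact ⟨k, hk.symm⟩

omit [DecidableEq α] [M.Finite] in
/-- A rank-`q` set has at least `q` points. -/
theorem le_card_of_eRk_eq {B : Finset α} {q : ℕ} (hr : M.eRk (B : Set α) = (q : ℕ∞)) : q ≤ B.card := by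
  have h := M.eRk_le_encard (B : Set α)
  rw [hr, Set.encard_coe_eq_coe_finsetCard] at h
  exact_mod_cast h

omit [DecidableEq α] [M.Finite] in
/-- A rank-`q` set with `q` points is independent. -/
theorem indep_of_eRk_eq_of_card_eq {B : Finset α} {q : ℕ} (hr : M.eRk (B : Set α) = (q : ℕ∞))
    (hc : B.card = q) : M.Indep (B : Set α) := by
  rw [Matroid.indep_iff_eRk_eq_encard_of_finite (Finset.finite_toSet B), hr,
    Set.encard_coe_eq_coe_finsetCard, hc]

/-- Every point of an independent set is a coloop of its restriction. -/
theorem coloopsOf_eq_self_of_indep {B : Finset α} (hI : M.Indep (B : Set α)) : coloopsOf M B = B := by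
  ext x
  rw [mem_coloopsOf]
  constructor
  · exact fun h => h.1
  · intro hx
    refine ⟨hx, ?_⟩
    rw [Finset.coe_erase]
    exact hI.notMem_closure_sdiff_of_mem hx

/-- `m(B) = q` and `w_∞(B) = 1/(q + 1)` on a basis. -/
theorem wInf_eq_of_mem_Bq {G B : Finset α} {q : ℕ} (hB : B ∈ Bq M G q) : wInf M B = 1 / ((q : ℚ) + 1) := by
  unfold Bq at hB
  rw [Finset.mem_filter, mem_Rq] at hB
  have hI := indep_of_eRk_eq_of_card_eq hB.1.2 hB.2
  unfold wInf mTr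
  rw [coloopsOf_eq_self_of_indep hI, hB.2, add_comm]

omit [DecidableEq α] in
/-- Membership in `Bq`. -/
theorem mem_Bq {G B : Finset α} {q : ℕ} :
    B ∈ Bq M G q ↔ B ⊆ G ∧ M.eRk (B : Set α) = (q : ℕ∞) ∧ B.card = q := by
  unfold Bq
  rw [Finset.mem_filter, mem_Rq, and_assoc]

omit [DecidableEq α] in
/-- Membership in `SNq`. -/
theorem mem_SNq {G S : Finset α} {q : ℕ} :
    S ∈ SNq M G q ↔ S ⊆ G ∧ M.eRk (S : Set α) = (q : ℕ∞) ∧ ¬ S.card = q := by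
  unfold SNq
  rw [Finset.mem_filter, mem_Rq, and_assoc]

omit [DecidableEq α] in
/-- A spanning non-basis has more than `q` points. -/
theorem lt_card_of_mem_SNq {G S : Finset α} {q : ℕ} (hS : S ∈ SNq M G q) : q < S.card := by
  rw [mem_SNq] at hS
  have := le_card_of_eRk_eq hS.2.1
  omega

/-! ## Every spanning subset contains a basis: `b(S) ≥ 1` -/

omit [DecidableEq α] in
/-- A rank-`q` subset `S` of `G ⊆ E` contains a basis of `G`. -/
theorem exists_mem_Bq_subset {G S : Finset α} {q : ℕ} (hG : G ⊆ gr M) (hS : S ⊆ G)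
    (hr : M.eRk (S : Set α) = (q : ℕ∞)) : ∃ B ∈ Bq M G q, B ⊆ S := by
  have hSE : (S : Set α) ⊆ M.E := by
    rw [← coe_gr M]
    exact_mod_cast hS.trans hG
  obtain ⟨I, hI⟩ := M.exists_isBasis (S : Set α) hSE
  have hIfin : I.Finite := (Finset.finite_toSet S).subset hI.subset
  refine ⟨hIfin.toFinset, ?_, ?_⟩
  · rw [mem_Bq]
    have hcoe : ((hIfin.toFinset : Finset α) : Set α) = I := Set.Finite.coe_toFinset hIfin
    have hIS : hIfin.toFinset ⊆ S := fun x hx => Finset.mem_coe.1 (hI.subset ((Set.Finite.mem_toFinset hIfin).1 hx))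
    refine ⟨hIS.trans hS, ?_, ?_⟩
    · rw [hcoe, hI.indep.eRk_eq_encard, ← hI.eRk_eq_encard, hr]
    · have h1 := hI.eRk_eq_encard
      rw [hr, ← hcoe, Set.encard_coe_eq_coe_finsetCard] at h1
      exact_mod_cast h1.symm
  · exact fun x hx => Finset.mem_coe.1 (hI.subset ((Set.Finite.mem_toFinset hIfin).1 hx))

/-- `b(S) ≥ 1` on every rank-`q` subset of `G`. -/
theorem bIn_pos {G S : Finset α} {q : ℕ} (hG : G ⊆ gr M) (hS : S ⊆ G)
    (hr : M.eRk (S : Set α) = (q : ℕ∞)) : 0 < bIn M G q S := by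
  obtain ⟨B, hB, hBS⟩ := exists_mem_Bq_subset hG hS hr
  unfold bIn
  exact Finset.card_pos.2 ⟨B, Finset.mem_filter.2 ⟨hB, hBS⟩⟩

/-! ## The coloops of a spanning non-basis: `m(S) ≤ q − 2` on a simple matroid -/

/-- Removing coloops of `M|S` drops the rank by exactly their number: `ρ(S ∖ C′) + |C′| = ρ(S)` for every
`C′ ⊆ coloopsOf M S`. -/
theorem eRk_sdiff_add_card_eq_of_subset_coloopsOf {S : Finset α} (hS : S ⊆ gr M) (C' : Finset α)
    (hC' : C' ⊆ coloopsOf M S) :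
    M.eRk ((S \ C' : Finset α) : Set α) + (C'.card : ℕ∞) = M.eRk (S : Set α) := by
  induction C' using Finset.induction_on with
  | empty => simp
  | insert c C' hc ih =>
    have hcS : c ∈ coloopsOf M S := hC' (Finset.mem_insert_self c C')
    have hC'S : C' ⊆ coloopsOf M S := (Finset.subset_insert c C').trans hC'
    have ih' := ih hC'S
    have hcSC' : c ∈ S \ C' := Finset.mem_sdiff.2 ⟨(mem_coloopsOf.1 hcS).1, hc⟩
    have hcl : c ∉ M.closure (((S \ C').erase c : Finset α) : Set α) := by
      intro h
      apply (mem_coloopsOf.1 hcS).2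
      refine M.closure_subset_closure ?_ h
      exact Finset.coe_subset.2 (Finset.erase_subset_erase c (Finset.sdiff_subset))
    have hstep := eRk_erase_add_one_of_notMem_closure (Finset.sdiff_subset.trans hS) hcSC' hcl
    rw [Finset.sdiff_insert, Finset.card_insert_of_notMem hc, ← ih', ← hstep]
    push_cast
    ring

/-- On a simple matroid a rank-`q` set with more than `q` points has at most `q − 2` coloops in its
restriction: `q − 1` coloops would leave two distinct points of rank `≤ 1`, `q` coloops a loop. -/
theorem mTr_add_two_le_of_spanning_nonbasis (hs : Simple M) {S : Finset α} {q : ℕ} (hS : S ⊆ gr M)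
    (hr : M.eRk (S : Set α) = (q : ℕ∞)) (hq : 1 ≤ q) (hcard : q < S.card) : mTr M S + 2 ≤ q := by
  set C := coloopsOf M S with hC
  have hCS : C ⊆ S := coloopsOf_subset S
  have hm : mTr M S ≤ q := mTr_le_of_eRk_eq hS hr
  have hsum := eRk_sdiff_add_card_eq_of_subset_coloopsOf hS C (Finset.Subset.refl _)
  rw [hr] at hsum
  obtain ⟨r, hr'⟩ := exists_eRk_eq_nat (M := M) (S \ C)
  rw [hr'] at hsum
  have hrm : r + C.card = q := by exact_mod_cast hsum
  have hcardC : C.card = mTr M S := rfl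
  have hsd : (S \ C).card = S.card - C.card := Finset.card_sdiff_of_subset hCS
  by_contra hlt
  push Not at hlt
  rcases Nat.eq_zero_or_pos r with h0 | hpos
  · -- `r = 0`: a point of `S ∖ C` is a loop; with a coloop `c` it gives a pair of rank `≤ 1`
    have hCne : C.card ≠ 0 := by omega
    obtain ⟨c, hc⟩ := Finset.card_pos.1 (Nat.pos_of_ne_zero hCne)
    have hSCne : (S \ C).card ≠ 0 := by omega
    obtain ⟨y, hy⟩ := Finset.card_pos.1 (Nat.pos_of_ne_zero hSCne)
    have hyc : y ≠ c := by
      intro h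
      rw [h] at hy
      exact (Finset.mem_sdiff.1 hy).2 hc
    have hT : insert c (S \ C) ⊆ gr M := by
      intro x hx
      rcases Finset.mem_insert.1 hx with rfl | hx
      · exact hS (hCS hc)
      · exact hS (Finset.mem_sdiff.1 hx).1
    have h2 := two_le_eRk_of_two_mem hs hT (Finset.mem_insert_of_mem hy) (Finset.mem_insert_self c _) hyc
    have hle : M.eRk ((insert c (S \ C) : Finset α) : Set α) ≤ M.eRk ((S \ C : Finset α) : Set α) + 1 := by
      rw [Finset.coe_insert]
      exact M.eRk_insert_le_add_one c _
    rw [hr', h0] at hle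
    have : (2 : ℕ∞) ≤ (0 : ℕ) + 1 := h2.trans hle
    norm_num at this
  · -- `r = 1`: two distinct points of `S ∖ C` have rank `2`
    have hr1' : r = 1 := by omega
    have h2card : 1 < (S \ C).card := by omega
    obtain ⟨u, hu, v, hv, huv⟩ := Finset.one_lt_card.1 h2card
    have h2 := two_le_eRk_of_two_mem hs (Finset.sdiff_subset.trans hS) hu hv huv
    rw [hr', hr1'] at h2
    norm_num at h2

/-- The surplus of a spanning non-basis of a simple matroid is nonnegative (indeed `≥ 2/((q − 1)(q + 1))`). -/
theorem surplus_nonneg (hs : Simple M) {G S : Finset α} {q : ℕ} (hG : G ⊆ gr M)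
    (hrG : M.eRk (G : Set α) = (q : ℕ∞)) (hS : S ∈ SNq M G q) : 0 ≤ surplus M G q S := by
  have hS' := mem_SNq.1 hS
  have hcard := lt_card_of_mem_SNq hS
  unfold surplus dem
  rcases Nat.eq_zero_or_pos q with hq0 | hq
  · -- `q = 0`: no demand (`ρ(G ∖ S) ≤ ρ(G) = 0`)
    have hle : M.eRk ((G \ S : Finset α) : Set α) ≤ M.eRk (G : Set α) :=
      M.eRk_mono (Finset.coe_subset.2 Finset.sdiff_subset)
    rw [hrG, hq0] at hle
    have hnot : ¬ ((2 : ℕ∞) ≤ M.eRk ((G \ S : Finset α) : Set α)) := by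
      intro h
      have : (2 : ℕ∞) ≤ ((0 : ℕ) : ℕ∞) := h.trans hle
      norm_num at this
    rw [if_neg hnot, hq0]
    simp
  · have hm := mTr_add_two_le_of_spanning_nonbasis hs (hS'.1.trans hG) hS'.2.1 hq hcard
    have hw : 1 / ((q : ℚ) - 1) ≤ wInf M S := by
      unfold wInf
      have hmq : (mTr M S : ℚ) + 2 ≤ q := by exact_mod_cast hm
      have hpos : (0 : ℚ) < 1 + (mTr M S : ℚ) := by positivity
      rw [div_le_div_iff₀ (by linarith) hpos]
      linarith
    have hq1 : (1 : ℚ) ≤ q := by exact_mod_cast hq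
    have hq2 : (2 : ℚ) ≤ q := by
      have : (mTr M S : ℚ) + 2 ≤ q := by exact_mod_cast hm
      have : (0 : ℚ) ≤ mTr M S := by positivity
      linarith
    have hkey : ((q : ℚ) + 2) / ((q : ℚ) + 1) ≤ (q : ℚ) * (1 / ((q : ℚ) - 1)) := by
      rw [mul_one_div, div_le_div_iff₀ (by linarith) (by linarith)]
      nlinarith
    split_ifs
    · have := mul_le_mul_of_nonneg_left hw (by positivity : (0 : ℚ) ≤ q)
      linarith
    · have := wInf_pos (M := M) S
      have : (0 : ℚ) ≤ q := by positivity
      nlinarith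

/-! ## The identity -/

/-- `Jq M G q 2 = Σ_{S ∈ R_q(G)} s(S)`: the type-`2` balance is the sum of the surpluses (the demand term is
`Φ·(N_q − DF_2)`). -/
theorem Jq_two_eq_sum_surplus (G : Finset α) (q : ℕ) :
    Jq M G q 2 = ∑ S ∈ Rq M G q, surplus M G q S := by
  unfold Jq surplus dem Nq DFq
  rw [Finset.sum_sub_distrib]
  have hsplit := Finset.card_filter_add_card_filter_not (s := Rq M G q)
    (fun B : Finset α => M.eRk ((G \ B : Finset α) : Set α) + 1 ≤ ((2 : ℕ) : ℕ∞))
  have hiff : ∀ B : Finset α, (¬ (M.eRk ((G \ B : Finset α) : Set α) + 1 ≤ ((2 : ℕ) : ℕ∞))) ↔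
      (2 : ℕ∞) ≤ M.eRk ((G \ B : Finset α) : Set α) := by
    intro B
    obtain ⟨k, hk⟩ := exists_eRk_eq_nat (M := M) (G \ B)
    rw [hk]
    constructor
    · intro h
      have : ¬ (k + 1 ≤ 2) := by
        intro h'
        apply h
        exact_mod_cast h'
      exact_mod_cast (by omega : 2 ≤ k)
    · intro h h'
      have h1 : 2 ≤ k := by exact_mod_cast h
      have h2 : k + 1 ≤ 2 := by exact_mod_cast h'
      omega
  have hsum : ∑ S ∈ Rq M G q,
      (if (2 : ℕ∞) ≤ M.eRk ((G \ S : Finset α) : Set α) then ((q : ℚ) + 2) / ((q : ℚ) + 1) else 0) =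
      (((q : ℚ) + 2) / ((q : ℚ) + 1)) *
        (((Rq M G q).filter (fun B : Finset α => ¬ (M.eRk ((G \ B : Finset α) : Set α) + 1 ≤
          ((2 : ℕ) : ℕ∞)))).card : ℚ) := by
    rw [← Finset.sum_filter, Finset.sum_const, nsmul_eq_mul, mul_comm]
    congr 2
    exact congrArg Finset.card (Finset.filter_congr (fun B _ => (hiff B).symm))
  rw [hsum]
  have hcast : (((Rq M G q).filter (fun B : Finset α => ¬ (M.eRk ((G \ B : Finset α) : Set α) + 1 ≤
      ((2 : ℕ) : ℕ∞)))).card : ℚ) = ((Rq M G q).card : ℚ) -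
      (((Rq M G q).filter (fun B : Finset α => M.eRk ((G \ B : Finset α) : Set α) + 1 ≤
        ((2 : ℕ) : ℕ∞))).card : ℚ) := by
    have := hsplit
    push_cast [← this]
    ring
  rw [hcast]
  push_cast
  ring

omit [DecidableEq α] in
/-- `R_q(G)` splits into the bases and the spanning non-bases. -/
theorem sum_Rq_eq_sum_Bq_add_sum_SNq (G : Finset α) (q : ℕ) (f : Finset α → ℚ) :
    ∑ S ∈ Rq M G q, f S = ∑ B ∈ Bq M G q, f B + ∑ S ∈ SNq M G q, f S := by
  unfold Bq SNq
  exact (Finset.sum_filter_add_sum_filter_not (Rq M G q) (fun B : Finset α => B.card = q) f).symm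

/-- **The exact double counting**: `Σ_{S spanning non-basis} s(S) = Σ_{B basis} rec(B)` (every non-basis
contains a basis, so the uniform charge `s(S)/b(S)` to its `b(S)` bases redistributes `s(S)` exactly). -/
theorem sum_surplus_eq_sum_rec {G : Finset α} {q : ℕ} (hG : G ⊆ gr M) :
    ∑ S ∈ SNq M G q, surplus M G q S = ∑ B ∈ Bq M G q, rec M G q B := by
  unfold rec
  -- each `s(S)` is the sum of `s(S)/b(S)` over the bases inside `S`
  have hS : ∀ S ∈ SNq M G q, surplus M G q S =
      ∑ B ∈ Bq M G q, if B ⊆ S then surplus M G q S / (bIn M G q S : ℚ) else 0 := by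
    intro S hS
    have hS' := mem_SNq.1 hS
    have hpos := bIn_pos hG hS'.1 hS'.2.1
    rw [← Finset.sum_filter, Finset.sum_const, nsmul_eq_mul]
    unfold bIn
    have hne : (((Bq M G q).filter (fun B : Finset α => B ⊆ S)).card : ℚ) ≠ 0 := by
      have : (0 : ℚ) < ((Bq M G q).filter (fun B : Finset α => B ⊆ S)).card := by
        unfold bIn at hpos
        exact_mod_cast hpos
      exact this.ne'
    field_simp
  rw [Finset.sum_congr rfl hS, Finset.sum_comm]
  apply Finset.sum_congr rfl
  intro B _
  rw [Finset.sum_filter]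

/-- **The identity of record** (mine-4 3893): on every `G`,
`J_2 = −(2/(q + 1))·#𝓑_dem + (q/(q + 1))·#𝓑_nondem + Σ_{S spanning non-basis} s(S)`. -/
theorem Jq_two_eq (G : Finset α) (q : ℕ) :
    Jq M G q 2 =
      -(2 / ((q : ℚ) + 1)) *
          (((Bq M G q).filter (fun B : Finset α => (2 : ℕ∞) ≤ M.eRk ((G \ B : Finset α) : Set α))).card : ℚ) +
        ((q : ℚ) / ((q : ℚ) + 1)) *
          (((Bq M G q).filter (fun B : Finset α => ¬ (2 : ℕ∞) ≤ M.eRk ((G \ B : Finset α) : Set α))).card : ℚ) +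
        ∑ S ∈ SNq M G q, surplus M G q S := by
  rw [Jq_two_eq_sum_surplus, sum_Rq_eq_sum_Bq_add_sum_SNq]
  congr 1
  -- the surplus of a basis is `q/(q + 1) − Φ·[dem]`
  have hB : ∀ B ∈ Bq M G q, surplus M G q B =
      if (2 : ℕ∞) ≤ M.eRk ((G \ B : Finset α) : Set α) then -(2 / ((q : ℚ) + 1)) else (q : ℚ) / ((q : ℚ) + 1) := by
    intro B hB
    unfold surplus dem
    rw [wInf_eq_of_mem_Bq hB]
    have hpos : (0 : ℚ) < (q : ℚ) + 1 := by positivity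
    split_ifs
    · field_simp
      ring
    · field_simp
      ring
  rw [Finset.sum_congr rfl hB, ← Finset.sum_filter_add_sum_filter_not (Bq M G q)
    (fun B : Finset α => (2 : ℕ∞) ≤ M.eRk ((G \ B : Finset α) : Set α))]
  rw [Finset.sum_congr rfl (fun B hB => if_pos (Finset.mem_filter.1 hB).2),
    Finset.sum_congr rfl (fun B hB => if_neg (Finset.mem_filter.1 hB).2)]
  rw [Finset.sum_const, Finset.sum_const, nsmul_eq_mul, nsmul_eq_mul]
  ring

/-! ## `(★)` closes the type-`2` balance -/

/-- `rec(B) ≥ 0` on a simple matroid (every surplus is nonnegative, every `b(S)` positive). -/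
theorem rec_nonneg (hs : Simple M) {G : Finset α} {q : ℕ} (hG : G ⊆ gr M)
    (hrG : M.eRk (G : Set α) = (q : ℕ∞)) (B : Finset α) : 0 ≤ rec M G q B := by
  unfold rec
  apply Finset.sum_nonneg
  intro S hS
  have hS' := (Finset.mem_filter.1 hS).1
  apply div_nonneg (surplus_nonneg hs hG hrG hS')
  exact_mod_cast Nat.zero_le _

/-- **`(★)` gives the type-`2` balance**: on a simple matroid, if every demanded basis of a rank-`q` set `G`
receives at least `2/(q + 1)` under the uniform charging, then `0 ≤ Jq M G q 2`. -/
theorem Jq_two_nonneg_of_star (hs : Simple M) {G : Finset α} {q : ℕ} (hG : G ⊆ gr M)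
    (hrG : M.eRk (G : Set α) = (q : ℕ∞)) (hstar : StarCharge M G q) : 0 ≤ Jq M G q 2 := by
  rw [Jq_two_eq_sum_surplus, sum_Rq_eq_sum_Bq_add_sum_SNq, sum_surplus_eq_sum_rec hG,
    ← Finset.sum_add_distrib]
  apply Finset.sum_nonneg
  intro B hB
  have hrec := rec_nonneg hs hG hrG B
  unfold surplus dem
  rw [wInf_eq_of_mem_Bq hB]
  have hpos : (0 : ℚ) < (q : ℚ) + 1 := by positivity
  split_ifs with hdem
  · have hst := hstar B hB hdem
    have : (q : ℚ) * (1 / ((q : ℚ) + 1)) - ((q : ℚ) + 2) / ((q : ℚ) + 1) = -(2 / ((q : ℚ) + 1)) := by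
      field_simp
      ring
    linarith
  · have : (0 : ℚ) ≤ (q : ℚ) * (1 / ((q : ℚ) + 1)) := by positivity
    linarith

end PercRepro.Star
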